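import Mathlib.AlgebraicGeometry.ValuativeCriterion
import Mathlib.RingTheory.Valuation.LocalSubring
import Literature.AlgebraicGeometry.Resolution.ZariskiRiemannSpace
import HarnessLib

/-!
# The centre of a valuation on a model

Topic: `Literature/AlgebraicGeometry/Resolution`. The basic objects of Zariski's patching
(Zariski–Samuel II, Ch. VI §17: models, "domination mapping" from the Riemann surface to a
complete model; Cossart–Piltant 2019, proof of Prop. 4.6 [arXiv v1: 4.4], Steps 3–4: centres of
valuations `v ∈ Zar(𝒳)` on projective models `𝒳_i → Spec A`), PROVED over Mathlib's valuative
criteria: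

* `KModel A K` — a MODEL of `K` over `A`: an `A`-scheme `π : X → Spec A` with a distinguished
  `K`-point `gen : Spec K → X` over `Spec K → Spec A` (for an integral birational model: its
  generic point).
* `KModel.IsCentre M v x` — `x ∈ X` is a CENTRE of the valuation ring `𝒪_v ∈ Zar(K/A)` on `M`:
  some `A`-morphism `Spec 𝒪_v → X` restricting to `gen` on `Spec K` sends the closed point to
  `x` ("`v` has centre `x`", "`𝒪_v` dominates `𝒪_{X,x}`").
* `KModel.exists_isCentre` — EXISTENCE for universally closed (e.g. proper) models: the
  existence half of the valuative criterion (EGA II 7.3.8; Mathlib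
  `UniversallyClosed.eq_valuativeCriterion`).
* `KModel.IsCentre.unique` — UNIQUENESS for separated models (Mathlib
  `IsSeparated.valuativeCriterion`).
* `KModel.IsCentre.map` — functoriality along morphisms of models (Zariski–Samuel's domination
  mapping `d_{M',M}` is compatible with centres).
* `KModel.exists_isCentre_of_specializes` — EVERY point `x` to which the distinguished point
  specialises is the centre of SOME valuation ring `𝒪 ∈ Zar(K/A)`: one dominating the image of
  `𝒪_{X,x}` in `K` (Chevalley; Mathlib `IsLocalRing.exists_factor_valuationRing`).

## References

* O. Zariski, P. Samuel, *Commutative Algebra* II, Ch. VI §17 (models; Lemmas 3, 4).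
  [ZariskiSamuel1960]
* A. Grothendieck, EGA II 7.3.8 (valuative criterion); The Stacks Project, Tags 01KF, 01KZ.
  [StacksProject]
* V. Cossart, O. Piltant, J. Algebra 529 (2019), proof of Prop. 4.6 (arXiv:1412.0868v1:
  Prop. 4.4), Step 3. [CossartPiltant2019]
-/

noncomputable section

open CategoryTheory AlgebraicGeometry TopologicalSpace IsLocalRing

namespace Literature.AlgebraicGeometry.Resolution

universe u

/-- A **model of `K` over `A`**: an `A`-scheme `π : X → Spec A` together with a `K`-valued point
`gen : Spec K → X` lying over `Spec K → Spec A` (Zariski–Samuel II, Ch. VI §17: the models of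
`K/k`; for an integral scheme birational over `A`, `gen` is the generic point).
[cite: ZariskiSamuel1960, Ch. VI §17] -/
structure KModel (A K : Type u) [CommRing A] [Field K] [Algebra A K] where
  /-- The underlying scheme. -/
  X : Scheme.{u}
  /-- The structure morphism to `Spec A`. -/
  π : X ⟶ Spec (.of A)
  /-- The distinguished `K`-point. -/
  gen : Spec (.of K) ⟶ X
  /-- Compatibility: `gen` lies over `Spec K → Spec A`. -/
  gen_π : gen ≫ π = Spec.map (CommRingCat.ofHom (algebraMap A K))

namespace KModel

variable {A K : Type u} [CommRing A] [Field K] [Algebra A K]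

/-- The ring map `A → 𝒪_v` of a point of `Zar(K/A)`. [folklore] -/
def toValuationSubringHom (v : ZariskiRiemannSpace A K) : A →+* v.asValuationSubring :=
  (algebraMap A K).codRestrict v.asValuationSubring v.algebraMap_mem

/-- `Spec K → Spec 𝒪_v`. [folklore] -/
def specKTo (v : ZariskiRiemannSpace A K) :
    Spec (.of K) ⟶ Spec (.of v.asValuationSubring) :=
  Spec.map (CommRingCat.ofHom (algebraMap v.asValuationSubring K))

/-- `Spec 𝒪_v → Spec A`. [folklore] -/
def specOTo (v : ZariskiRiemannSpace A K) :
    Spec (.of v.asValuationSubring) ⟶ Spec (.of A) :=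
  Spec.map (CommRingCat.ofHom (toValuationSubringHom v))

/-- `Spec K → Spec 𝒪_v → Spec A` is `Spec K → Spec A`. [folklore] -/
@[reassoc]
theorem specKTo_specOTo (v : ZariskiRiemannSpace A K) :
    specKTo v ≫ specOTo v = Spec.map (CommRingCat.ofHom (algebraMap A K)) := by
  rw [specKTo, specOTo, ← Spec.map_comp]
  rfl

/-- The valuative square of a model at a valuation ring `𝒪_v ∈ Zar(K/A)`:
`Spec K → X` (the distinguished point) over `Spec 𝒪_v → Spec A`. [folklore] -/
def valuativeCommSq (M : KModel A K) (v : ZariskiRiemannSpace A K) : ValuativeCommSq M.π where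
  R := v.asValuationSubring
  K := K
  i₁ := M.gen
  i₂ := specOTo v
  commSq := ⟨by rw [M.gen_π, ← specKTo_specOTo]; rfl⟩

/-- **`x` is a centre of `v` on the model `M`**: there is an `A`-morphism `l : Spec 𝒪_v → X`
which restricts to the distinguished point on `Spec K` and maps the closed point to `x`
(Zariski–Samuel II, Ch. VI §17: `𝒪_v` dominates the local ring of `x`; Cossart–Piltant: "the
center of `v`"). [cite: ZariskiSamuel1960, Ch. VI §17] -/
def IsCentre (M : KModel A K) (v : ZariskiRiemannSpace A K) (x : M.X) : Prop :=
  ∃ l : Spec (.of v.asValuationSubring) ⟶ M.X,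
    specKTo v ≫ l = M.gen ∧ l ≫ M.π = specOTo v ∧ l (closedPoint v.asValuationSubring) = x

/-- **Existence of centres on universally closed (e.g. proper) models**: the existence part
of the valuative criterion (EGA II 7.3.8; Stacks 01KF). [cite: StacksProject, Tag 01KF] -/
theorem exists_isCentre (M : KModel A K) [UniversallyClosed M.π] (v : ZariskiRiemannSpace A K) :
    ∃ x : M.X, M.IsCentre v x := by
  have hex : ValuativeCriterion.Existence M.π := by
    have h := (inferInstance : UniversallyClosed M.π)
    rw [UniversallyClosed.eq_valuativeCriterion] at h
    exact h.1
  obtain ⟨l, hl₁, hl₂⟩ := (hex (M.valuativeCommSq v)).exists_lift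
  exact ⟨l (closedPoint v.asValuationSubring), l, hl₁, hl₂, rfl⟩

/-- On a separated model two lifts `Spec 𝒪_v → X` of the valuative square coincide (the
uniqueness part of the valuative criterion, Stacks 01KZ). [cite: StacksProject, Tag 01KZ] -/
theorem lift_unique (M : KModel A K) [IsSeparated M.π] (v : ZariskiRiemannSpace A K)
    {l₁ l₂ : Spec (.of v.asValuationSubring) ⟶ M.X}
    (h₁ : specKTo v ≫ l₁ = M.gen) (h₁' : l₁ ≫ M.π = specOTo v)
    (h₂ : specKTo v ≫ l₂ = M.gen) (h₂' : l₂ ≫ M.π = specOTo v) : l₁ = l₂ := by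
  have hsub : Subsingleton (M.valuativeCommSq v).commSq.LiftStruct :=
    IsSeparated.valuativeCriterion M.π (M.valuativeCommSq v)
  have := hsub.elim ⟨l₁, h₁, h₁'⟩ ⟨l₂, h₂, h₂'⟩
  exact congrArg CommSq.LiftStruct.l this

/-- **Uniqueness of the centre on separated models.** [cite: StacksProject, Tag 01KZ] -/
theorem IsCentre.unique {M : KModel A K} [IsSeparated M.π] {v : ZariskiRiemannSpace A K}
    {x y : M.X} (hx : M.IsCentre v x) (hy : M.IsCentre v y) : x = y := by
  obtain ⟨l₁, h₁, h₁', rfl⟩ := hx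
  obtain ⟨l₂, h₂, h₂', rfl⟩ := hy
  rw [M.lift_unique v h₁ h₁' h₂ h₂']

/-- A **morphism of models**: an `A`-morphism compatible with the distinguished points
(Zariski–Samuel's domination `M ≤ M'`). [cite: ZariskiSamuel1960, Ch. VI §17] -/
structure Hom (M N : KModel A K) where
  /-- The underlying morphism of schemes. -/
  f : M.X ⟶ N.X
  f_π : f ≫ N.π = M.π
  gen_f : M.gen ≫ f = N.gen

/-- **Centres are functorial**: the image of a centre of `v` on `M` under a morphism of models
`M → N` is a centre of `v` on `N` (Zariski–Samuel II, Ch. VI §17: the domination mapping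
commutes with the maps from the Riemann surface, Lemmas 3–4). [cite: ZariskiSamuel1960, Ch. VI §17] -/
theorem IsCentre.map {M N : KModel A K} (φ : Hom M N) {v : ZariskiRiemannSpace A K} {x : M.X}
    (hx : M.IsCentre v x) : N.IsCentre v (φ.f x) := by
  obtain ⟨l, h₁, h₂, rfl⟩ := hx
  refine ⟨l ≫ φ.f, by rw [← Category.assoc, h₁, φ.gen_f], by rw [Category.assoc, φ.f_π, h₂], rfl⟩

/-- Hence on a separated target the centre of `v` on `N` IS the image of its centre on `M`.
[cite: ZariskiSamuel1960, Ch. VI §17] -/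
theorem IsCentre.eq_map {M N : KModel A K} [IsSeparated N.π] (φ : Hom M N)
    {v : ZariskiRiemannSpace A K} {x : M.X} {y : N.X} (hx : M.IsCentre v x)
    (hy : N.IsCentre v y) : y = φ.f x :=
  hy.unique (hx.map φ)

/-! ## Every point is a centre -/

/-- The distinguished point of the model (the image of `Spec K`). [folklore] -/
def genericPt (M : KModel A K) : M.X :=
  M.gen (closedPoint K)

/-- **Every specialization of the distinguished point is the centre of some valuation ring of
`K` over `A`**: for `x` with `genericPt ⤳ x`, a valuation ring `𝒪` of `K` dominating the image
of `𝒪_{X,x} → 𝒪_{X,ξ} → K` (Chevalley's extension theorem) contains the image of `A`, and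
`Spec 𝒪 → Spec 𝒪_{X,x} → X` exhibits `x` as the centre of `𝒪` (Zariski–Samuel II, Ch. VI §17:
every point of a model is dominated by some valuation). [cite: ZariskiSamuel1960, Ch. VI §17] -/
theorem exists_isCentre_of_specializes (M : KModel A K) {x : M.X} (hx : M.genericPt ⤳ x) :
    ∃ v : ZariskiRiemannSpace A K, M.IsCentre v x := by
  -- the ring map `𝒪_{X,x} → 𝒪_{X,ξ} → K`
  let ψ' : M.X.presheaf.stalk x ⟶ CommRingCat.of K :=
    M.X.presheaf.stalkSpecializes hx ≫ Scheme.stalkClosedPointTo M.gen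
  let ψ : M.X.presheaf.stalk x →+* K := ψ'.hom
  -- `gen = Spec ψ ≫ fromSpecStalk x`
  have hgen : Spec.map ψ' ≫ M.X.fromSpecStalk x = M.gen := by
    rw [Spec.map_comp, Category.assoc, Scheme.SpecMap_stalkSpecializes_fromSpecStalk]
    exact Scheme.Spec_stalkClosedPointTo_fromSpecStalk M.gen
  -- a valuation ring `𝒪` of `K` dominating the image of `𝒪_{X,x}`
  obtain ⟨O, hO, hloc⟩ := IsLocalRing.exists_factor_valuationRing ψ
  -- `A ⊆ 𝒪`: the structure map `A → K` factors through `ψ`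
  have hπgen : Spec.map ψ' ≫ (M.X.fromSpecStalk x ≫ M.π) =
      Spec.map (CommRingCat.ofHom (algebraMap A K)) := by
    rw [← Category.assoc, hgen, M.gen_π]
  have hA : ∀ a : A, ∃ z, ψ z = algebraMap A K a := by
    intro a
    -- `fromSpecStalk x ≫ π : Spec 𝒪_{X,x} → Spec A` is `Spec` of a ring map `χ : A → 𝒪_{X,x}`
    let χ := Spec.preimage (M.X.fromSpecStalk x ≫ M.π)
    have hχ : Spec.map χ = M.X.fromSpecStalk x ≫ M.π := Spec.map_preimage _
    have h2 : Spec.map (χ ≫ ψ') = Spec.map (CommRingCat.ofHom (algebraMap A K)) := by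
      rw [Spec.map_comp, hχ, hπgen]
    have h3 : χ ≫ ψ' = CommRingCat.ofHom (algebraMap A K) := Spec.map_injective h2
    refine ⟨χ.hom a, ?_⟩
    have := congrArg (fun g : CommRingCat.of A ⟶ CommRingCat.of K => g.hom a) h3
    exact this
  let v : ZariskiRiemannSpace A K := ⟨O, fun a => by
    obtain ⟨z, hz⟩ := hA a
    rw [← hz]; exact hO z⟩
  refine ⟨v, ?_⟩
  -- the lift `Spec 𝒪 → Spec 𝒪_{X,x} → X`
  let ρ : M.X.presheaf.stalk x →+* O := ψ.codRestrict O.toSubring hO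
  haveI : IsLocalHom ρ := hloc
  let ρ' : M.X.presheaf.stalk x ⟶ CommRingCat.of v.asValuationSubring := CommRingCat.ofHom ρ
  haveI : IsLocalHom ρ'.hom := hloc
  let l : Spec (.of v.asValuationSubring) ⟶ M.X := Spec.map ρ' ≫ M.X.fromSpecStalk x
  have hρψ : ρ' ≫ CommRingCat.ofHom (algebraMap v.asValuationSubring K) = ψ' := by
    ext z; rfl
  refine ⟨l, ?_, ?_, ?_⟩
  · -- restricts to `gen` on `Spec K`
    change Spec.map (CommRingCat.ofHom (algebraMap v.asValuationSubring K)) ≫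
      Spec.map ρ' ≫ M.X.fromSpecStalk x = M.gen
    rw [← Spec.map_comp_assoc, hρψ, hgen]
  · -- lies over `Spec 𝒪 → Spec A`: both are `Spec` of ring maps `A → 𝒪` agreeing in `K`
    obtain ⟨χ₁, hχ₁⟩ : ∃ χ₁, Spec.map χ₁ = l ≫ M.π := ⟨_, Spec.map_preimage _⟩
    rw [← hχ₁, specOTo]
    congr 1
    ext a
    change ((χ₁.hom a : v.asValuationSubring) : K) = algebraMap A K a
    -- compare after composing with `Spec K → Spec 𝒪`
    have h1 : Spec.map (χ₁ ≫ CommRingCat.ofHom (algebraMap v.asValuationSubring K)) =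
        Spec.map (CommRingCat.ofHom (algebraMap A K)) := by
      rw [Spec.map_comp, hχ₁, ← Category.assoc]
      change (specKTo v ≫ l) ≫ M.π = _
      have : specKTo v ≫ l = M.gen := by
        change Spec.map (CommRingCat.ofHom (algebraMap v.asValuationSubring K)) ≫
          Spec.map ρ' ≫ M.X.fromSpecStalk x = M.gen
        rw [← Spec.map_comp_assoc, hρψ, hgen]
      rw [this, M.gen_π]
    have h2 := Spec.map_injective h1
    exact congrArg (fun g : CommRingCat.of A ⟶ CommRingCat.of K => g.hom a) h2
  · -- maps the closed point to `x`
    change (Spec.map ρ' ≫ M.X.fromSpecStalk x) (closedPoint v.asValuationSubring) = x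
    rw [Scheme.Hom.comp_apply]
    have : Spec.map ρ' (closedPoint v.asValuationSubring) = closedPoint (M.X.presheaf.stalk x) :=
      IsLocalRing.comap_closedPoint ρ
    rw [this]
    exact Scheme.fromSpecStalk_closedPoint

/-- On an irreducible model whose distinguished point is the generic point, EVERY point is the
centre of some valuation ring over `A`. [cite: ZariskiSamuel1960, Ch. VI §17] -/
theorem exists_isCentre_of_isGenericPoint (M : KModel A K)
    (hgen : IsGenericPoint M.genericPt (Set.univ : Set M.X)) (x : M.X) :
    ∃ v : ZariskiRiemannSpace A K, M.IsCentre v x :=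
  M.exists_isCentre_of_specializes (hgen.specializes (Set.mem_univ x))

end KModel

end Literature.AlgebraicGeometry.Resolution

end
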